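import Summits.QuantumFields.BalabanUV.T4Continuum.Support.VariationalVectorPoincare
import Summits.QuantumFields.BalabanUV.T4Continuum.Support.VariationalVectorAverage

/-!
# T⁴ programme, spine node NE2 (U1a), lane P2 — LEAF V-P, CORE (i) FOR GENERAL LINE TRANSPORTS NEAR A PRODUCT: the Poincaré inequality for the
# line-sum average `Q_T` of `E`-valued 1-forms when the line transports `T` are within `γ` of leaf-01-g5's product transports `T′∘Π`
# (`t4/skeletons/NE2-t4-ne2-p2.md` v0.15 §2.E row V-P; model level; one level, every torus; cell `pub-balaban`)

NE2 formalisation swarm `b2b-balaban-t4-ne2-formalise-*`, leaf prover 10 GEN 3 (`prover-b2b-balaban-t4-ne2-formalise-leaf-10-g3-0`); journal INTENT CLAIMS.log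
2026-08-20 13:13Z (my XREAD INFO-2 on p218347, GAPS C-ne2leaf10g3-1; leaf-01-g5's NOT-TAKEN item «the `hPf`-level Poincaré»).  On top of leaf-01-g5's
`VariationalVectorPoincare.qWV_le_line_poincare` (p218347: the rough Poincaré inequality for the PRODUCT line transports `lineT T′ R′`, over leaf-02-g4's V-COL-P)
and `VariationalVectorAverage` (p218350: Jensen for `Q_T`) — BY NAME; no definition.

THE POINT.  The retired road owner's ruling (CLAIMS.log l.11674) makes GENERAL line-indexed transports `QvL n M T` the carriers of the vector tower (they compose:
`VectorLineComposite.compL`, `VariationalVectorTower`), while the Poincaré lemma of record is stated for the product transports `T′(b)∘Π_t(b)` built from the rough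
form's own bond transports; a composite `compL (T k) (T′ k)` is such a product only up to FED⁺'s one-block mismatch.  Since `Q_T` is LINEAR IN `T`, a `γ`-perturbation
of the transports moves the average by at most `γ·√(qWV)` in the unit-lattice `ℓ²` size, which the Poincaré inequality absorbs for `64γ² ≤ 1`:
 * §1 `QvL_sub_transport` (`Q_T W − Q_S W = Q_{T−S} W`), `norm_QvL_le_of_norm_le` ∕ `sum_sq_QvL_le_of_norm_le` ∕ `nsqV_QvL_le_of_norm_le` (V-AVG's Jensen count re-run
   with a general bound `‖T‖ ≤ c`: `nsqV M (Q_T W) ≤ c²·qWV n M W`), **`nsqV_QvL_sub_le`** (`‖T − S‖ ≤ γ ⟹ nsqV M (Q_T W − Q_S W) ≤ γ²·qWV n M W`),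
   `nsqV_QvL_le_two` (`nsqV M (Q_S W) ≤ 2·nsqV M (Q_T W) + 2γ²·qWV n M W`);
 * §2 **`qWV_le_near_line_poincare`**: leaf-01-g5's binders (finite-dimensional Hilbert `E`, UNITARY site transports `T′`, contractive `R′`, in-block defect `w` with
   `2d·(n·w)² ≤ ½`) + `‖T(y,j,t,μ) − (T′∘Π)(y,j,t,μ)‖ ≤ γ`, `64γ² ≤ 1` ⟹ `qWV n M W ≤ 64·nsqV M (QvL n M T W) + 40·(n^{−d}·(n²·roughV n M R′ W))`;
 * §3 **`qWV_le_of_garding_near`**: a displayed Gårding inequality (Går) against `nsqV M (Q_T W)` ⟹ the `hPc` binder of `vector_pair_bracket_sqrt` for the carrier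
   `Qk := QvL n M T` with `C_P = max(40κ, 64 + 40κ′)`; at block side `n·L` for the composite data it is the `hPf` binder through `VariationalVectorTower.coerciveV_transport`.
WHAT IS NOT HERE: (Går) (leaf-09-g6's line); the size of `γ` for composite ∕ contour transports against the product ones (a FED⁺-mismatch count, geometric input).

HONEST FRAMING (T4-DAG p. 1).  Model level; transports DATA (no identification with Bałaban's `U(Γ)` — c5); [folklore] linearity + Jensen on top of the landed Poincaré
lemma; nothing printed is a hypothesis; no `def`, no `def … : Prop`, no `sorry`; axioms standard.  V-P NOT proved (only its averaging half, now for general carriers);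
NE2 NOT proved; spine PROVED 0∕9 unchanged; rung (B)+1 finite T⁴ — NOT infinite volume, NOT mass gap, NOT Clay.  HONEST DEPENDENCY (cell, verbatim): continuum YM
on T⁴ ⇐ BetaPertH ∧ nine spine estimates (0/9 proved); BetaPertH ⇐ (D1) ∧ (D4) ∧ CAP+tail; G-an2-4 gates asym, D1 and NE2/3/4.
-/

noncomputable section

namespace Summit.QuantumFields.BalabanUV.T4Continuum.VariationalVectorPoincareNear

open Finset
open Literature.MathematicalPhysics.QuantumFieldTheory.Balaban1983to89
open Literature.MathematicalPhysics.QuantumFieldTheory.Balaban1983to89.B5Prop11Plancherel (Tor fine unitVec)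
open Literature.MathematicalPhysics.QuantumFieldTheory.Balaban1983to89.B5Block118 (tstep bpt)
open Literature.MathematicalPhysics.QuantumFieldTheory.Balaban1983to89.B5Blocks16 (blockOf)
open Summit.QuantumFields.BalabanUV.T4Continuum.VariationalCovariantFederbush (sq_sum_le_card_mul sum_blocks_translate)
open Summit.QuantumFields.BalabanUV.T4Continuum.VectorBlockTrialForm (nsqV nsqV_nonneg QvL roughV roughV_nonneg)
open Summit.QuantumFields.BalabanUV.T4Continuum.VariationalVectorForm (ScV qWV ScV_nonneg qWV_nonneg norm_sub_sq_le_two)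
open Summit.QuantumFields.BalabanUV.T4Continuum.VariationalVectorFederbush (lineT card_digits sq_sum_fin_le norm_invPow)
open Summit.QuantumFields.BalabanUV.T4Continuum.VariationalVectorPoincare (qWV_le_line_poincare)

variable {d : ℕ}

/-! ## §1 `Q_T` is linear in the transports: `γ`-close transports give `γ²·qWV`-close averages -/

section General

variable {E : Type*} [NormedAddCommGroup E] [NormedSpace ℂ E]
variable (n : ℕ) [NeZero n] (M : Fin d → ℕ) [hM : ∀ μ, NeZero (M μ)]
variable {T S : Tor M → (Fin d → Fin n) → Fin n → Fin d → (E →L[ℂ] E)}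

omit [NeZero n] hM in
/-- `Q_T W − Q_S W = Q_{T−S} W` pointwise: the line-sum average is linear in the line transports. [folklore] -/
theorem QvL_sub_transport (T S : Tor M → (Fin d → Fin n) → Fin n → Fin d → (E →L[ℂ] E)) (W : Tor (fine n M) → Fin d → E) (y : Tor M) (μ : Fin d) :
    QvL n M T W y μ - QvL n M S W y μ = QvL n M (fun y j t μ => T y j t μ - S y j t μ) W y μ := by
  simp only [QvL, sub_apply, sum_sub_distrib, smul_sub]

omit [NeZero n] hM in
/-- Jensen, pointwise, with a general bound: `‖T‖ ≤ c ⟹ ‖Q_T W(y,μ)‖ ≤ c·n^{−(d+1)}·Σ_j Σ_t ‖W(n·y + j + t e_μ, μ)‖`. [folklore] -/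
theorem norm_QvL_le_of_norm_le {c : ℝ} (hT : ∀ y j t μ, ‖T y j t μ‖ ≤ c) (W : Tor (fine n M) → Fin d → E) (y : Tor M) (μ : Fin d) :
    ‖QvL n M T W y μ‖ ≤ c * (((n : ℝ) ^ (d + 1))⁻¹ * ∑ j : Fin d → Fin n, ∑ t : Fin n, ‖W (bpt n M y j + tstep (fine n M) μ t) μ‖) := by
  unfold QvL
  rw [norm_smul, norm_invPow, mul_left_comm, mul_sum]
  refine mul_le_mul_of_nonneg_left ((norm_sum_le _ _).trans (sum_le_sum fun j _ => ?_)) (by positivity)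
  rw [mul_sum]
  refine (norm_sum_le _ _).trans (sum_le_sum fun t _ => ?_)
  calc _ ≤ ‖T y j t μ‖ * ‖W (bpt n M y j + tstep (fine n M) μ t) μ‖ := ContinuousLinearMap.le_opNorm _ _
    _ ≤ c * _ := mul_le_mul_of_nonneg_right (hT _ _ _ _) (norm_nonneg _)

/-- Jensen, summed per component, with a general bound (V-AVG's count `sum_sq_QvL_le` re-run with the factor `c`):
`Σ_y ‖Q_T W(y,μ)‖² ≤ c²·n^{−d}·Σ_x ‖W(x,μ)‖²`. [folklore] -/
theorem sum_sq_QvL_le_of_norm_le {c : ℝ} (hT : ∀ y j t μ, ‖T y j t μ‖ ≤ c) (W : Tor (fine n M) → Fin d → E) (μ : Fin d) :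
    ∑ y, ‖QvL n M T W y μ‖ ^ 2 ≤ c ^ 2 * (((n : ℝ) ^ d)⁻¹ * ∑ x, ‖W x μ‖ ^ 2) := by
  have hn : (0 : ℝ) < n := by exact_mod_cast Nat.pos_of_ne_zero (NeZero.ne n)
  -- Cauchy–Schwarz per block (as in `VariationalVectorAverage.sum_sq_QvL_le`)
  have hcs : ∀ y : Tor M, (∑ j : Fin d → Fin n, ∑ t : Fin n, ‖W (bpt n M y j + tstep (fine n M) μ t) μ‖) ^ 2
      ≤ (n : ℝ) ^ d * n * ∑ j : Fin d → Fin n, ∑ t : Fin n, ‖W (bpt n M y j + tstep (fine n M) μ t) μ‖ ^ 2 := by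
    intro y
    calc _ ≤ (n : ℝ) ^ d * ∑ j : Fin d → Fin n, (∑ t : Fin n, ‖W (bpt n M y j + tstep (fine n M) μ t) μ‖) ^ 2 := by
          have h := sq_sum_le_card_mul Finset.univ (fun j : Fin d → Fin n => ∑ t : Fin n, ‖W (bpt n M y j + tstep (fine n M) μ t) μ‖)
          rwa [card_digits] at h
      _ ≤ (n : ℝ) ^ d * ∑ j : Fin d → Fin n, ((n : ℝ) * ∑ t : Fin n, ‖W (bpt n M y j + tstep (fine n M) μ t) μ‖ ^ 2) := by
          gcongr with j _
          exact sq_sum_fin_le n _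
      _ = _ := by simp only [← mul_sum]; ring
  -- every fine point lies on `n` lines
  have hcount : ∑ y : Tor M, ∑ j : Fin d → Fin n, ∑ t : Fin n, ‖W (bpt n M y j + tstep (fine n M) μ t) μ‖ ^ 2 = n * ∑ x, ‖W x μ‖ ^ 2 := by
    calc ∑ y : Tor M, ∑ j : Fin d → Fin n, ∑ t : Fin n, ‖W (bpt n M y j + tstep (fine n M) μ t) μ‖ ^ 2
        = ∑ t : Fin n, ∑ y : Tor M, ∑ j : Fin d → Fin n, ‖W (bpt n M y j + tstep (fine n M) μ t) μ‖ ^ 2 := by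
          calc _ = ∑ y : Tor M, ∑ t : Fin n, ∑ j : Fin d → Fin n, ‖W (bpt n M y j + tstep (fine n M) μ t) μ‖ ^ 2 :=
                sum_congr rfl fun y _ => Finset.sum_comm
            _ = _ := Finset.sum_comm
      _ = ∑ _t : Fin n, ∑ x, ‖W x μ‖ ^ 2 := sum_congr rfl fun t _ => sum_blocks_translate n M (fun x => ‖W x μ‖ ^ 2) (tstep (fine n M) μ t)
      _ = _ := by rw [sum_const, Finset.card_univ, Fintype.card_fin, nsmul_eq_mul]
  calc ∑ y, ‖QvL n M T W y μ‖ ^ 2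
      ≤ ∑ y : Tor M, (c * (((n : ℝ) ^ (d + 1))⁻¹ * ∑ j : Fin d → Fin n, ∑ t : Fin n, ‖W (bpt n M y j + tstep (fine n M) μ t) μ‖)) ^ 2 :=
        sum_le_sum fun y _ => pow_le_pow_left₀ (norm_nonneg _) (norm_QvL_le_of_norm_le n M hT W y μ) 2
    _ ≤ ∑ y : Tor M, c ^ 2 * ((((n : ℝ) ^ (d + 1))⁻¹) ^ 2 * ((n : ℝ) ^ d * n * ∑ j : Fin d → Fin n, ∑ t : Fin n, ‖W (bpt n M y j + tstep (fine n M) μ t) μ‖ ^ 2)) := by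
        refine sum_le_sum fun y _ => ?_
        rw [mul_pow, mul_pow]
        exact mul_le_mul_of_nonneg_left (mul_le_mul_of_nonneg_left (hcs y) (sq_nonneg _)) (sq_nonneg _)
    _ = c ^ 2 * ((((n : ℝ) ^ (d + 1))⁻¹) ^ 2 * ((n : ℝ) ^ d * n * (n * ∑ x, ‖W x μ‖ ^ 2))) := by rw [← mul_sum, ← mul_sum, ← mul_sum, hcount]
    _ = _ := by field_simp; ring

/-- **JENSEN WITH A GENERAL BOUND, in the road owner's letters**: `‖T‖ ≤ c ⟹ nsqV M (Q_T W) ≤ c²·qWV n M W`. [folklore] -/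
theorem nsqV_QvL_le_of_norm_le {c : ℝ} (hT : ∀ y j t μ, ‖T y j t μ‖ ≤ c) (W : Tor (fine n M) → Fin d → E) :
    nsqV M (QvL n M T W) ≤ c ^ 2 * qWV n M W := by
  unfold nsqV qWV
  calc ∑ y, ∑ μ, ‖QvL n M T W y μ‖ ^ 2 = ∑ μ, ∑ y, ‖QvL n M T W y μ‖ ^ 2 := Finset.sum_comm
    _ ≤ ∑ μ, c ^ 2 * (((n : ℝ) ^ d)⁻¹ * ∑ x, ‖W x μ‖ ^ 2) := sum_le_sum fun μ _ => sum_sq_QvL_le_of_norm_le n M hT W μ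
    _ = c ^ 2 * (((n : ℝ) ^ d)⁻¹ * ∑ x, ∑ μ, ‖W x μ‖ ^ 2) := by rw [← mul_sum, ← mul_sum, Finset.sum_comm]

/-- **`γ`-CLOSE TRANSPORTS GIVE `γ²·qWV`-CLOSE AVERAGES**: `‖T − S‖ ≤ γ ⟹ nsqV M (Q_T W − Q_S W) ≤ γ²·qWV n M W`. [folklore] -/
theorem nsqV_QvL_sub_le {γ : ℝ} (hTS : ∀ y j t μ, ‖T y j t μ - S y j t μ‖ ≤ γ) (W : Tor (fine n M) → Fin d → E) :
    nsqV M (QvL n M T W - QvL n M S W) ≤ γ ^ 2 * qWV n M W := by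
  have h : QvL n M T W - QvL n M S W = QvL n M (fun y j t μ => T y j t μ - S y j t μ) W := by
    funext y μ
    exact QvL_sub_transport n M T S W y μ
  rw [h]
  exact nsqV_QvL_le_of_norm_le n M hTS W

/-- the average under `S` is controlled by the average under a `γ`-close `T`: `nsqV M (Q_S W) ≤ 2·nsqV M (Q_T W) + 2·γ²·qWV n M W`. [folklore] -/
theorem nsqV_QvL_le_two {γ : ℝ} (hTS : ∀ y j t μ, ‖T y j t μ - S y j t μ‖ ≤ γ) (W : Tor (fine n M) → Fin d → E) :
    nsqV M (QvL n M S W) ≤ 2 * nsqV M (QvL n M T W) + 2 * (γ ^ 2 * qWV n M W) := by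
  have hdiff := nsqV_QvL_sub_le n M hTS W
  have hpt : ∀ (y : Tor M) (μ : Fin d), ‖QvL n M S W y μ‖ ^ 2 ≤ 2 * ‖QvL n M T W y μ‖ ^ 2 + 2 * ‖(QvL n M T W - QvL n M S W) y μ‖ ^ 2 := by
    intro y μ
    have h := norm_sub_sq_le_two (QvL n M T W y μ) (QvL n M T W y μ - QvL n M S W y μ)
    rw [sub_sub_cancel] at h
    exact h
  unfold nsqV at hdiff ⊢
  calc ∑ y, ∑ μ, ‖QvL n M S W y μ‖ ^ 2 ≤ ∑ y, ∑ μ, (2 * ‖QvL n M T W y μ‖ ^ 2 + 2 * ‖(QvL n M T W - QvL n M S W) y μ‖ ^ 2) :=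
        sum_le_sum fun y _ => sum_le_sum fun μ _ => hpt y μ
    _ = 2 * ∑ y, ∑ μ, ‖QvL n M T W y μ‖ ^ 2 + 2 * ∑ y, ∑ μ, ‖(QvL n M T W - QvL n M S W) y μ‖ ^ 2 := by
        simp only [sum_add_distrib, mul_sum]
    _ ≤ _ := by linarith [hdiff]

end General

/-! ## §2 The Poincaré inequality for line transports near a product -/

section Hilbert

variable {E : Type*} [NormedAddCommGroup E] [InnerProductSpace ℂ E] [CompleteSpace E]
variable (n : ℕ) [NeZero n] (M : Fin d → ℕ) [hM : ∀ μ, NeZero (M μ)]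
variable {T' : Tor (fine n M) → (E →L[ℂ] E)} {R' : Tor (fine n M) → Fin d → (E →L[ℂ] E)}
variable {T : Tor M → (Fin d → Fin n) → Fin n → Fin d → (E →L[ℂ] E)}

/-- **LEAF V-P, CORE (i), GENERAL LINE TRANSPORTS NEAR A PRODUCT** (physical units): finite-dimensional Hilbert `E`; UNITARY site transports `T′`, contractive
bond transports `R′`, the IN-BLOCK defect `‖R′(x,μ)∘T′(x+e_μ)⋆∘T′(x) − 1‖ ≤ w` on bonds with both ends in one block, `2d·(n·w)² ≤ ½` (leaf-01-g5's ∕ leaf-02-g4's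
binders verbatim), and line transports `T` with `‖T(y,j,t,μ) − T′(b_j)∘Π^μ_t(b_j)‖ ≤ γ`, `64γ² ≤ 1`:
`qWV n M W ≤ 64·nsqV M (QvL n M T W) + 40·(n^{−d}·(n²·roughV n M R′ W))`. [folklore] -/
theorem qWV_le_near_line_poincare [FiniteDimensional ℂ E] (hT' : ∀ x, T' x ∈ unitary (E →L[ℂ] E)) (hR' : ∀ x μ, ‖R' x μ‖ ≤ 1) {w : ℝ}
    (hw : ∀ (x : Tor (fine n M)) (μ : Fin d), blockOf n M (x + unitVec (fine n M) μ) = blockOf n M x →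
      ‖R' x μ * star (T' (x + unitVec (fine n M) μ)) * T' x - 1‖ ≤ w)
    (hsmall : 2 * (d : ℝ) * ((n : ℝ) * w) ^ 2 ≤ 1 / 2) {γ : ℝ}
    (hnear : ∀ y j t μ, ‖T y j t μ - lineT n M T' R' y j t μ‖ ≤ γ) (hγs : 64 * γ ^ 2 ≤ 1) (W : Tor (fine n M) → Fin d → E) :
    qWV n M W ≤ 64 * nsqV M (QvL n M T W) + 40 * (((n : ℝ) ^ d)⁻¹ * ((n : ℝ) ^ 2 * roughV n M R' W)) := by
  have hP := qWV_le_line_poincare n M hT' hR' hw hsmall W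
  have h2 := nsqV_QvL_le_two n M hnear W
  have hq0 : 0 ≤ qWV n M W := qWV_nonneg n M W
  have habs : 32 * (γ ^ 2 * qWV n M W) ≤ qWV n M W / 2 := by nlinarith
  nlinarith [h2, hP, habs]

/-! ## §3 The reduction V-P ⟸ (Går), for general line transports -/

/-- **V-P ⟸ (Går), GENERAL CARRIER**: with the data of `qWV_le_near_line_poincare` and a displayed Gårding inequality for the fixed vector form against the rough form
modulo the `Q_T`-average, `n^{−d}·(n²·roughV R′ W) ≤ κ·ScV n M R′ G W + κ′·nsqV M (Q_T W)` (the gauge functional's job — NOT proved here), the `hPc` binder of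
`VariationalVectorForm.vector_pair_bracket_sqrt` holds for the carrier `Qk := QvL n M T` with `C_P = max(40κ, 64 + 40κ′)`. [folklore] -/
theorem qWV_le_of_garding_near [FiniteDimensional ℂ E] (hT' : ∀ x, T' x ∈ unitary (E →L[ℂ] E)) (hR' : ∀ x μ, ‖R' x μ‖ ≤ 1) {w : ℝ}
    (hw : ∀ (x : Tor (fine n M)) (μ : Fin d), blockOf n M (x + unitVec (fine n M) μ) = blockOf n M x →
      ‖R' x μ * star (T' (x + unitVec (fine n M) μ)) * T' x - 1‖ ≤ w)
    (hsmall : 2 * (d : ℝ) * ((n : ℝ) * w) ^ 2 ≤ 1 / 2) {γ : ℝ}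
    (hnear : ∀ y j t μ, ‖T y j t μ - lineT n M T' R' y j t μ‖ ≤ γ) (hγs : 64 * γ ^ 2 ≤ 1)
    {G : (Tor (fine n M) → Fin d → E) → ℝ} (hG0 : ∀ W, 0 ≤ G W) {κ κ' : ℝ}
    (hGar : ∀ W, ((n : ℝ) ^ d)⁻¹ * ((n : ℝ) ^ 2 * roughV n M R' W) ≤ κ * ScV n M R' G W + κ' * nsqV M (QvL n M T W))
    (W : Tor (fine n M) → Fin d → E) :
    qWV n M W ≤ max (40 * κ) (64 + 40 * κ') * (ScV n M R' G W + nsqV M (QvL n M T W)) := by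
  have h := qWV_le_near_line_poincare n M hT' hR' hw hsmall hnear hγs W
  have hS0 : 0 ≤ ScV n M R' G W := ScV_nonneg n M R' hG0 W
  have hN0 : 0 ≤ nsqV M (QvL n M T W) := nsqV_nonneg M _
  have h1 : 40 * κ ≤ max (40 * κ) (64 + 40 * κ') := le_max_left _ _
  have h2 : 64 + 40 * κ' ≤ max (40 * κ) (64 + 40 * κ') := le_max_right _ _
  calc qWV n M W ≤ 64 * nsqV M (QvL n M T W) + 40 * (((n : ℝ) ^ d)⁻¹ * ((n : ℝ) ^ 2 * roughV n M R' W)) := h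
    _ ≤ 64 * nsqV M (QvL n M T W) + 40 * (κ * ScV n M R' G W + κ' * nsqV M (QvL n M T W)) := by linarith [hGar W]
    _ = (40 * κ) * ScV n M R' G W + (64 + 40 * κ') * nsqV M (QvL n M T W) := by ring
    _ ≤ max (40 * κ) (64 + 40 * κ') * ScV n M R' G W + max (40 * κ) (64 + 40 * κ') * nsqV M (QvL n M T W) :=
        add_le_add (mul_le_mul_of_nonneg_right h1 hS0) (mul_le_mul_of_nonneg_right h2 hN0)
    _ = _ := by ring

end Hilbert

end Summit.QuantumFields.BalabanUV.T4Continuum.VariationalVectorPoincareNear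

end
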